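import Mathlib
import Literature.Analysis.ODE.InverseSquareLadder
import Literature.Analysis.ODE.IntegratingFactorVanishing
import HarnessLib

/-!
# Pre-images under the Darboux ladder, based at a point

Analysis/ODE support file (everything proved). For smooth `ι` with a smooth primitive `I`
(`I' = ι`) and a base point `a`, every `w ∈ C^m` has a pre-image `u ∈ C^{m+n}` under
`ladder ι n` (`InverseSquareLadder.lean`), obtained by the inverse rungs
`R_k F = e^{kI}∫_a^· e^{−kI}F` (`FirstOrderLinearRightInverse.lean`), and the base point controls the
Taylor jet: if `w` vanishes to order `j − 1` at `a` then `u` vanishes to order `j + n − 1` at `a` and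
`u^{(j+n)}(a) = w^{(j)}(a)` (`exists_ladder_preimage`; `IntegratingFactorVanishing.lean` rung by
rung). For far-field Cauchy data `h` (`j = 0`) this says: `h = ladder ι ℓ h̃` with
`h̃^{(i)}(a) = 0 (i < ℓ)`, `h̃^{(ℓ)}(a) = h(a)` — the input of the Hardy chain modulo the single
kernel direction `ladder ι ℓ ((x−a)^ℓ/ℓ!)` (route PhotonSphereChannels, `FixedModeChannels`, far
side, stmt-FinalStateConjecture-10048). Folklore.
-/

noncomputable section

namespace Literature.Analysis.ODE

open Set Filter Topology intervalIntegral

variable {ι I : ℝ → ℝ}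

/-- **One inverse rung solves the rung equation**: with `v = e^{kI}∫_a^· e^{−kI} w`,
`ladderStep ι k v = w`. [folklore] -/
theorem ladderStep_integratingFactor (hI' : ∀ x, HasDerivAt I (ι x) x) {w : ℝ → ℝ}
    (hw : Continuous w) (k : ℕ) (a : ℝ) :
    ladderStep ι k (fun x => Real.exp ((k : ℝ) * I x)
        * ∫ y in a..x, Real.exp (-((k : ℝ) * I y)) * w y) = w := by
  have hIk : ∀ x, HasDerivAt (fun x => (k : ℝ) * I x) ((k : ℝ) * ι x) x := fun x =>
    (hI' x).const_mul (k : ℝ)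
  funext x
  rw [ladderStep_apply]
  have h := deriv_integratingFactor_sub (c := fun x => (k : ℝ) * ι x)
    (I := fun x => (k : ℝ) * I x) hIk hw a x
  simpa [mul_assoc] using h

/-- **Pre-images under the ladder with controlled jet at the base point.** [folklore] -/
theorem exists_ladder_preimage (hI : ContDiff ℝ (⊤ : ℕ∞) I)
    (hI' : ∀ x, HasDerivAt I (ι x) x) (a : ℝ) (n : ℕ) :
    ∀ {m j : ℕ} {w : ℝ → ℝ}, ContDiff ℝ m w → j ≤ m → (∀ i < j, iteratedDeriv i w a = 0) →
      ∃ u : ℝ → ℝ, ContDiff ℝ ((m + n : ℕ) : ℕ∞) u ∧ ladder ι n u = w ∧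
        (∀ i < j + n, iteratedDeriv i u a = 0) ∧ iteratedDeriv (j + n) u a = iteratedDeriv j w a := by
  induction n with
  | zero =>
    intro m j w hw _ hw0
    exact ⟨w, by simpa using hw, rfl, by simpa using hw0, by simp⟩
  | succ n ih =>
    intro m j w hw hjm hw0
    -- the rung `R_{n+1}`
    set k : ℕ := n + 1 with hk
    set v : ℝ → ℝ := fun x => Real.exp ((k : ℝ) * I x)
      * ∫ y in a..x, Real.exp (-((k : ℝ) * I y)) * w y with hv
    have hIk : ContDiff ℝ (m + 1) fun x => (k : ℝ) * I x :=
      contDiff_const.mul (by exact_mod_cast contDiff_infty.1 hI (m + 1))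
    have hIk' : ∀ x, HasDerivAt (fun x => (k : ℝ) * I x) ((k : ℝ) * ι x) x := fun x =>
      (hI' x).const_mul (k : ℝ)
    have hvC : ContDiff ℝ (m + 1) v := contDiff_integratingFactor hIk hw a
    obtain ⟨hvan, htop⟩ := iteratedDeriv_integratingFactor_vanishing (c := fun x => (k : ℝ) * ι x)
      hIk hIk' hw hjm hw0
    have hstep : ladderStep ι k v = w := ladderStep_integratingFactor hI' hw.continuous k a
    -- induction hypothesis applied to `v` with `(m+1, j+1)`
    have hvC' : ContDiff ℝ ((m + 1 : ℕ) : ℕ∞) v := by exact_mod_cast hvC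
    have hvan' : ∀ i < j + 1, iteratedDeriv i v a = 0 := fun i hi => hvan i (Nat.lt_succ_iff.1 hi)
    obtain ⟨u, huC, hlad, huvan, hutop⟩ := ih hvC' (Nat.succ_le_succ hjm) hvan'
    refine ⟨u, ?_, ?_, ?_, ?_⟩
    · have : m + 1 + n = m + (n + 1) := by ring
      rw [← this]; exact huC
    · rw [ladder_succ, hlad, ← hk, hstep]
    · intro i hi
      exact huvan i (by omega)
    · have : j + (n + 1) = j + 1 + n := by ring
      rw [this, hutop, htop]

end Literature.Analysis.ODE
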